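import Mathlib
import Summits.NavierStokesRegularity.NavierStokesRegularity.Theorems.EulerZoomLiouvillePowerGaugeEulerLiouvilleAxisymDSS
import Literature.Analysis.FluidPDE.BackwardParticleMap
import HarnessLib

/-!
# Crux E `PowerGaugeEulerLiouville` (stmt-NavierStokesRegularity-19832): THE DISCRETE SWIRL RATCHET — a classical axisymmetric DSS member whose swirl
# is BOUNDED on ONE past slice is swirl-free (no Casimir, no exponent condition); with `ω_θ/r ∈ L²` it is trivial (width seat ns-ezl-w3 g3)

Route №10 `EulerZoomLiouville` (NavierStokesRegularity), crux E; LEAD ns-typeII-p2 g12; the DSS branch of `stub_nonSelfSimilarRest` (skeleton predicate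
`IsDSSClassicalTame ρ u p`, second disjunct, v34: ns-typeII-p3's `AxisymNoSwirl.ae_eq_zero_of_gauge_of_axisym_dss` — classical axisymmetric `l`-DSS member with
bounded `u`/`∇u` on compact time intervals, swirl Casimir `(r u_θ)^k ∈ L²` for ONE `k ≥ 1` WITH `2kρ ≠ 3` (uniformly on compact intervals) and `ω_θ/r ∈ L²` ⇒ trivial).
The swirl-killing step there is Kelvin's `D_t(r u_θ) = 0` read through the `L^{2k}` Casimir; here it is read POINTWISE along particle trajectories:

* TRANSPORT: `DSSSwirlRatchet.isUniformlyLipschitzOn_of_bounds` (bounded `∇u` on compact past intervals ⇒ Cauchy–Lipschitz hypotheses on `(−∞,0)`),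
  `DSSSwirlRatchet.swirl_eq_swirl_evolutionMap` (`Γ(τ₂, x) = Γ(τ₁, φ(τ₂ → τ₁) x)` for all `τ₁, τ₂ < 0` — characteristics, the tree's
  `eq_apply_evolutionMap_target_of_transport_eq_zero` with `∂ₜΓ = −DΓ[u]`, `AxisymNoSwirl.timeDerivWithin_swirl_eq_neg`), hence `DSSSwirlRatchet.swirl_bound_all_slices`:
  a swirl bound `|Γ(τ₀, ·)| ≤ B` on ONE slice holds on EVERY slice.
* RATCHET: the class DSS symmetry `u(τ,y) = l^{1+ρ} u(l^{2+ρ}τ, l y)` gives `Γ(τ, z) = l^{−ρ} Γ(l^{−(2+ρ)}τ, l⁻¹z)` (`DSSSwirlRatchet.swirl_dss_down`), so a uniform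
  bound `B` improves itself to `l^{−ρ}B`, `l^{−2ρ}B`, … (`swirl_bound_iterate`): **`DSSSwirlRatchet.hasNoSwirl_of_dss_of_bounded_swirl`** — every slice is swirl-free.
* MEMBER FORM `DSSSwirlRatchet.ae_eq_zero_of_gauge_of_axisym_dss_boundedSwirl` = `AxisymNoSwirl.ae_eq_zero_of_gauge_of_axisym_dss` with the swirl Casimir clause
  `∃ k ≥ 1, 2kρ ≠ 3, (r u_θ)^k ∈ L² uniformly` REPLACED by `∃ τ₀ < 0, ∃ B, ∀ y, |swirl (u τ₀) y| ≤ B` (the `ω_θ/r ∈ L²` clause of the swirl-free DSS stratum stays).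
  For the LEAD: the axisymmetric disjunct of `IsDSSClassicalTame ρ u p` may take «bounded swirl on one past slice» as an alternative to its Casimir clause.

Physically the bound is automatic for zoom limits at the axis (`r u_θ` is scale-invariant and transported), so this is the natural form of the DSS swirl hypothesis.
WHAT THIS IS NOT: not NS regularity, not the crux E — a widening of one DSS stratum of the crux CLASS 19832 (MODEL lattice; E/NS strata) `--supports` stmt-19832; the
swirl-free DSS endgame still needs `ω_θ/r ∈ L²`; 19832 OPEN.  [folklore; MajdaBertozziCUP2002 §1.6 (1.53), §2.3.3; Chae2007CMPEuler Thm 2.2 + Note added p. 6]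
-/

noncomputable section

-- flat `Theorems/<Route><Decl>…` files of one crux share the namespace of the crux (tree convention: `Summit.<S>.<S>.…`)
set_option linter.dupNamespace false

open MeasureTheory Set Filter Topology Metric Function InnerProductSpace
open scoped RealInnerProductSpace NNReal ENNReal ContDiff

namespace Summit.NavierStokesRegularity.NavierStokesRegularity.Theorems.PowerGaugeEulerLiouville

open Literature.Analysis Literature.Analysis.FluidPDE Literature.Analysis.FunctionSpaces

namespace DSSSwirlRatchet

variable {u : ℝ → EuclideanSpace ℝ (Fin 3) → EuclideanSpace ℝ (Fin 3)} {p : ℝ → EuclideanSpace ℝ (Fin 3) → ℝ}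

/-! ### Cauchy–Lipschitz hypotheses from bounded gradients on compact past intervals -/

/-- A classical solution on `(−∞,0)` with `‖∇u‖` bounded on every compact past interval satisfies the Cauchy–Lipschitz hypotheses
`ODE.IsUniformlyLipschitzOn u (Iio 0)` (continuity in time from joint smoothness; mean value inequality slice by slice). [folklore] -/
theorem isUniformlyLipschitzOn_of_bounds (hns : IsClassicalNSSolutionOn (Iio 0) 0 0 u p)
    (hbdd : ∀ s t : ℝ, s < t → t < 0 → ∃ B : ℝ, ∀ τ ∈ Icc s t, ∀ y : EuclideanSpace ℝ (Fin 3),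
      ‖u τ y‖ ≤ B ∧ ‖fderiv ℝ (u τ) y‖ ≤ B) :
    ODE.IsUniformlyLipschitzOn u (Iio 0) := by
  refine ⟨fun x => ?_, fun C hC hCS => ?_⟩
  · -- continuity in time for each point
    have h1 : ContinuousOn (uncurry u) (Iio (0 : ℝ) ×ˢ (univ : Set (EuclideanSpace ℝ (Fin 3)))) := hns.smooth_velocity.continuousOn
    have h2 : ContinuousOn (fun t : ℝ => ((t, x) : ℝ × EuclideanSpace ℝ (Fin 3))) (Iio 0) :=
      (continuous_id.prodMk continuous_const).continuousOn
    exact h1.comp h2 fun t ht => mk_mem_prod ht (mem_univ _)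
  · rcases C.eq_empty_or_nonempty with hCe | hCne
    · exact ⟨0, fun t ht => by rw [hCe] at ht; exact absurd ht (notMem_empty _)⟩
    · have hbA := hC.bddAbove
      have hbB := hC.bddBelow
      have hsup : sSup C ∈ C := hC.sSup_mem hCne
      have hsup0 : sSup C < 0 := hCS hsup
      obtain ⟨B, hB⟩ := hbdd (sInf C - 1) (sSup C) (by linarith [csInf_le hbB hsup]) hsup0
      refine ⟨Real.toNNReal B, fun t ht => ?_⟩
      have htI : t ∈ Icc (sInf C - 1) (sSup C) := ⟨by linarith [csInf_le hbB ht], le_csSup hbA ht⟩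
      have hdiff : Differentiable ℝ (u t) := (hns.contDiff_velocity (hCS ht)).differentiable (by simp)
      refine lipschitzWith_of_nnnorm_fderiv_le hdiff fun y => ?_
      rw [← norm_toNNReal]
      exact Real.toNNReal_le_toNNReal (hB t htI y).2

/-! ### Transport of the swirl along particle trajectories -/

/-- **`Γ(τ₂, x) = Γ(τ₁, φ(τ₂ → τ₁) x)`** for a classical axisymmetric Euler flow on `(−∞,0)` with the Cauchy–Lipschitz hypotheses: the swirl `Γ = swirl (u τ)` satisfies
`∂ₜΓ + DΓ[u] = 0` (`AxisymNoSwirl.timeDerivWithin_swirl_eq_neg`), so it is its value at any other time composed with the two-time particle-trajectory map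
(`eq_apply_evolutionMap_target_of_transport_eq_zero`). [cite: MajdaBertozziCUP2002, §1.6 Cor. 1.2 (1.53)] -/
theorem swirl_eq_swirl_evolutionMap (hns : IsClassicalNSSolutionOn (Iio 0) 0 0 u p)
    (hax : ∀ τ : ℝ, τ < 0 → IsAxisymmetric (u τ)) (hL : ODE.IsUniformlyLipschitzOn u (Iio 0))
    {τ₁ τ₂ : ℝ} (hτ₁ : τ₁ < 0) (hτ₂ : τ₂ < 0) (x : EuclideanSpace ℝ (Fin 3)) :
    swirl (u τ₂) x = swirl (u τ₁) (ODE.evolutionMap u τ₂ τ₁ x) := by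
  have hf : IsSmoothSpaceTimeOn (Iio 0) (fun s => swirl (u s)) := hns.smooth_velocity.swirl_family
  have htr : ∀ s ∈ Iio (0 : ℝ), ∀ y : EuclideanSpace ℝ (Fin 3),
      FluidPDE.timeDerivWithin (Iio 0) (fun s => swirl (u s)) s y + fderiv ℝ (swirl (u s)) y (u s y) = 0 := by
    intro s hs y
    rw [AxisymNoSwirl.timeDerivWithin_swirl_eq_neg (uniqueDiffOn_Iio 0) hns (fun σ hσ => hax σ hσ) hs y]
    ring
  exact eq_apply_evolutionMap_target_of_transport_eq_zero hL (convex_Iio 0) hf htr hτ₁ hτ₂ x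

/-- **A swirl bound on ONE past slice holds on EVERY past slice** (transport by the particle trajectories). [cite: MajdaBertozziCUP2002, §1.6 Cor. 1.2 (1.53)] -/
theorem swirl_bound_all_slices (hns : IsClassicalNSSolutionOn (Iio 0) 0 0 u p)
    (hax : ∀ τ : ℝ, τ < 0 → IsAxisymmetric (u τ)) (hL : ODE.IsUniformlyLipschitzOn u (Iio 0))
    {τ₀ : ℝ} (hτ₀ : τ₀ < 0) {B : ℝ} (hB : ∀ y, |swirl (u τ₀) y| ≤ B) :
    ∀ τ : ℝ, τ < 0 → ∀ y, |swirl (u τ) y| ≤ B := by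
  intro τ hτ y
  rw [swirl_eq_swirl_evolutionMap hns hax hL hτ₀ hτ y]
  exact hB _

/-! ### The discrete ratchet -/

/-- **DSS down-scaling of the swirl**: the class DSS symmetry `u(σ, y) = l^{1+ρ} u(l^{2+ρ}σ, l y)` (`σ < 0`, `l > 1`) gives, at `σ = l^{−(2+ρ)}τ`,
`Γ(τ, z) = l^{−ρ} · Γ(l^{−(2+ρ)}τ, l⁻¹ z)` — the swirl at time `τ` is `l^{−ρ}` times a swirl value at the LATER time `l^{−(2+ρ)}τ`. [folklore] -/
theorem swirl_dss_down {ρ : ℝ} {l : ℝ} (hl : 1 < l)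
    (hdss : ∀ τ : ℝ, τ < 0 → ∀ y, u τ y = (l ^ (1 + ρ)) • u ((l ^ (2 + ρ)) * τ) (l • y))
    {τ : ℝ} (hτ : τ < 0) (z : EuclideanSpace ℝ (Fin 3)) :
    swirl (u τ) z = (l ^ ρ)⁻¹ * swirl (u ((l ^ (2 + ρ))⁻¹ * τ)) (l⁻¹ • z) := by
  have hl0 : 0 < l := by linarith
  have hl2 : 0 < l ^ (2 + ρ) := Real.rpow_pos_of_pos hl0 _
  have hlρ : 0 < l ^ ρ := Real.rpow_pos_of_pos hl0 _
  set σ : ℝ := (l ^ (2 + ρ))⁻¹ * τ with hσ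
  have hσ0 : σ < 0 := by rw [hσ]; exact mul_neg_of_pos_of_neg (inv_pos.2 hl2) hτ
  have hστ : (l ^ (2 + ρ)) * σ = τ := by rw [hσ, ← mul_assoc, mul_inv_cancel₀ hl2.ne', one_mul]
  -- the slice at `σ` is a rescaling of the slice at `τ`
  have hfun : u σ = fun y => (l ^ (1 + ρ)) • u τ (l • y) := by
    funext y; rw [hdss σ hσ0 y, hστ]
  have h1 := AxisymNoSwirl.swirl_smul_comp_smul (u τ) (l ^ (1 + ρ)) hl0.ne' (l⁻¹ • z)
  rw [← hfun, smul_inv_smul₀ hl0.ne'] at h1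
  -- `l^{1+ρ} · l⁻¹ = l^ρ`
  have hpow : l ^ (1 + ρ) * l⁻¹ = l ^ ρ := by
    rw [Real.rpow_add hl0, Real.rpow_one, mul_comm (l : ℝ) (l ^ ρ), mul_assoc, mul_inv_cancel₀ hl0.ne', mul_one]
  rw [hpow] at h1
  rw [h1, ← mul_assoc, inv_mul_cancel₀ hlρ.ne', one_mul]

/-- **The ratchet**: a swirl bound `B` valid on ALL past slices improves to `(l^ρ)⁻¹^k · B` for every `k`. [folklore] -/
theorem swirl_bound_iterate {ρ : ℝ} {l : ℝ} (hl : 1 < l)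
    (hdss : ∀ τ : ℝ, τ < 0 → ∀ y, u τ y = (l ^ (1 + ρ)) • u ((l ^ (2 + ρ)) * τ) (l • y))
    {B : ℝ} (hB : ∀ τ : ℝ, τ < 0 → ∀ y, |swirl (u τ) y| ≤ B) (k : ℕ) :
    ∀ τ : ℝ, τ < 0 → ∀ y, |swirl (u τ) y| ≤ ((l ^ ρ)⁻¹) ^ k * B := by
  have hl0 : 0 < l := by linarith
  have hl2 : 0 < l ^ (2 + ρ) := Real.rpow_pos_of_pos hl0 _
  have hlρ : 0 < l ^ ρ := Real.rpow_pos_of_pos hl0 _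
  induction k with
  | zero => intro τ hτ y; simpa using hB τ hτ y
  | succ k ih =>
    intro τ hτ z
    have hσ0 : (l ^ (2 + ρ))⁻¹ * τ < 0 := mul_neg_of_pos_of_neg (inv_pos.2 hl2) hτ
    rw [swirl_dss_down hl hdss hτ z, abs_mul, abs_of_pos (inv_pos.2 hlρ), pow_succ]
    have h1 := ih _ hσ0 (l⁻¹ • z)
    calc (l ^ ρ)⁻¹ * |swirl (u ((l ^ (2 + ρ))⁻¹ * τ)) (l⁻¹ • z)| ≤ (l ^ ρ)⁻¹ * (((l ^ ρ)⁻¹) ^ k * B) :=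
          mul_le_mul_of_nonneg_left h1 (inv_pos.2 hlρ).le
      _ = ((l ^ ρ)⁻¹) ^ k * (l ^ ρ)⁻¹ * B := by ring

/-- **THE DISCRETE SWIRL RATCHET: a classical axisymmetric DSS member (`ρ > 0`, factor `l > 1`, bounded `u`/`∇u` on compact past intervals) whose swirl is bounded on ONE
past slice is SWIRL-FREE on every past slice.**  (Transport spreads the bound to all slices; the DSS symmetry ratchets it down by `l^{−ρ} < 1` indefinitely.)
[cite: Chae2007CMPEuler, Thm 2.2 + Note added p. 6] -/
theorem hasNoSwirl_of_dss_of_bounded_swirl {ρ : ℝ} (hρ : 0 < ρ) (hns : IsClassicalNSSolutionOn (Iio 0) 0 0 u p)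
    (hax : ∀ τ : ℝ, τ < 0 → IsAxisymmetric (u τ)) {l : ℝ} (hl : 1 < l)
    (hdss : ∀ τ : ℝ, τ < 0 → ∀ y, u τ y = (l ^ (1 + ρ)) • u ((l ^ (2 + ρ)) * τ) (l • y))
    (hbdd : ∀ s t : ℝ, s < t → t < 0 → ∃ B : ℝ, ∀ τ ∈ Icc s t, ∀ y : EuclideanSpace ℝ (Fin 3),
      ‖u τ y‖ ≤ B ∧ ‖fderiv ℝ (u τ) y‖ ≤ B)
    {τ₀ : ℝ} (hτ₀ : τ₀ < 0) {B : ℝ} (hB : ∀ y, |swirl (u τ₀) y| ≤ B) :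
    ∀ τ : ℝ, τ < 0 → HasNoSwirl (u τ) := by
  have hL := isUniformlyLipschitzOn_of_bounds hns hbdd
  have hall := swirl_bound_all_slices hns hax hL hτ₀ hB
  have hl0 : 0 < l := by linarith
  have hlρ1 : 1 < l ^ ρ := Real.one_lt_rpow hl hρ
  have hq0 : 0 ≤ (l ^ ρ)⁻¹ := (inv_pos.2 (by linarith)).le
  have hq1 : (l ^ ρ)⁻¹ < 1 := inv_lt_one_of_one_lt₀ hlρ1
  have hB0 : 0 ≤ B := (abs_nonneg _).trans (hB 0)
  intro τ hτ y
  -- `|Γ| ≤ q^k B → 0`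
  have hlim : Tendsto (fun k : ℕ => ((l ^ ρ)⁻¹) ^ k * B) atTop (𝓝 (0 * B)) :=
    (tendsto_pow_atTop_nhds_zero_of_lt_one hq0 hq1).mul_const B
  rw [zero_mul] at hlim
  have hle : |swirl (u τ) y| ≤ 0 :=
    ge_of_tendsto' hlim fun k => swirl_bound_iterate hl hdss hall k τ hτ y
  exact abs_eq_zero.1 (le_antisymm hle (abs_nonneg _))

end DSSSwirlRatchet

/-! ### Member form -/

namespace DSSSwirlRatchet

/-- **MEMBER FORM — THE AXISYMMETRIC DSS STRATUM WITH BOUNDED SWIRL ON ONE SLICE.**  A member of Seregin's power-gauged ancient Euler class (`ρ > 0`; weak gradient `H`,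
gauges `≤ c`) that is classical on `(−∞,0)` with AXISYMMETRIC slices, discretely self-similar with factor `l > 1`, with bounded `u`/`∇u` on compact past intervals,
`ω_θ/r ∈ L²` uniformly there, and `|swirl (u τ₀)| ≤ B` on ONE slice `τ₀ < 0`, vanishes a.e. (`hasNoSwirl_of_dss_of_bounded_swirl` ⇒ swirl-free slices ⇒ ns-typeII-p3's
`AxisymNoSwirl.ae_eq_zero_of_gauge_of_axisymNoSwirl_dss`).  Replaces the swirl Casimir clause `(r u_θ)^k ∈ L²`, `2kρ ≠ 3`, of `AxisymNoSwirl.ae_eq_zero_of_gauge_of_axisym_dss`.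
[folklore; Chae2007CMPEuler Thm 2.2] -/
theorem ae_eq_zero_of_gauge_of_axisym_dss_boundedSwirl {ρ : ℝ} (hρ : 0 < ρ)
    {u : ℝ → EuclideanSpace ℝ (Fin 3) → EuclideanSpace ℝ (Fin 3)} {p : ℝ → EuclideanSpace ℝ (Fin 3) → ℝ}
    {H : ℝ → EuclideanSpace ℝ (Fin 3) → EuclideanSpace ℝ (Fin 3) →L[ℝ] EuclideanSpace ℝ (Fin 3)} {c : ℝ≥0}
    (hH : HasWeakSpatialGradientOn (slab (EuclideanSpace ℝ (Fin 3)) (Iio 0) isOpen_Iio) u H)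
    (hc : ∀ a : ℝ, 0 < a → ENNReal.ofReal (a ^ (2 * ρ)) * cknA a (0 : ℝ × EuclideanSpace ℝ (Fin 3)) u +
        ENNReal.ofReal (a ^ ρ) * cknE a (0 : ℝ × EuclideanSpace ℝ (Fin 3)) H +
        ENNReal.ofReal (a ^ (2 * ρ)) * cknD a (0 : ℝ × EuclideanSpace ℝ (Fin 3)) p ≤ (c : ℝ≥0∞))
    (hns : IsClassicalNSSolutionOn (Iio 0) 0 0 u p)
    (hax : ∀ τ : ℝ, τ < 0 → IsAxisymmetric (u τ))
    {l : ℝ} (hl : 1 < l)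
    (hdss : ∀ τ : ℝ, τ < 0 → ∀ y, u τ y = (l ^ (1 + ρ)) • u ((l ^ (2 + ρ)) * τ) (l • y))
    (hbdd : ∀ s t : ℝ, s < t → t < 0 → ∃ B : ℝ, ∀ τ ∈ Icc s t, ∀ y,
      ‖u τ y‖ ≤ B ∧ ‖fderiv ℝ (u τ) y‖ ≤ B)
    (hswirl : ∃ τ₀ : ℝ, τ₀ < 0 ∧ ∃ B : ℝ, ∀ y, |swirl (u τ₀) y| ≤ B)
    (hL2 : ∀ s t : ℝ, s < t → t < 0 → ∃ N : ℝ, ∀ τ ∈ Icc s t,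
      Integrable (fun y => angVortQuot (u τ) y ^ 2) ∧ ∫ y, angVortQuot (u τ) y ^ 2 ≤ N) :
    uncurry u =ᵐ[volume.restrict (Iio (0 : ℝ) ×ˢ (univ : Set (EuclideanSpace ℝ (Fin 3))))] 0 := by
  obtain ⟨τ₀, hτ₀, B, hB⟩ := hswirl
  exact AxisymNoSwirl.ae_eq_zero_of_gauge_of_axisymNoSwirl_dss hρ hH hc hns hax
    (hasNoSwirl_of_dss_of_bounded_swirl hρ hns hax hl hdss hbdd hτ₀ hB) hl hdss hbdd hL2

end DSSSwirlRatchet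

end Summit.NavierStokesRegularity.NavierStokesRegularity.Theorems.PowerGaugeEulerLiouville

end
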